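import Summits.QuantumFields.YangMills.Theorems.UnitScaleTiltProp7CombLadderCountOffset
import HarnessLib

/-!
# Route `UnitScaleTilt`, crux K1 «MinimiserStabilityRegPr» (stmt-QuantumFields-19200), route-R E′ path (α′), S3 K-form engine, row (R4′) — FILE 9j (ℤ^d cell letters):
# THE COMB-LOOP COMMUTATOR SQUARED, SUMMED OVER A BOX: `Σ_(v∈box) N_m(V(Γ_(0,v) ∪ μ ∪ −Γ_(0,v+e_μ)))² ≤ (|t|·R)·Σ_i (2R+1)^(|t|−i)·Σ_(q∈box) 2·(f(q,(t_i,+)) + f(q,(t_i,−)))`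
# with the CANONICAL letter `f(q,l) = ‖[V_q(l μ l̄ μ̄), R(V(Γ_(0,q))⁻¹)m]‖²` — the plaquette word at `q` against `m` transported along the COMB to `q` (both sign cases of the `μ`-run
# reduce to it by ✓ `treeWord_disp_prefix`); = ✓p670923 §4 ∘ Cauchy–Schwarz ∘ px9 g3's ✓p672698 count — the ℤ^d half of the (R4′) assembly (α)

Cell `ym3-torus`, D-0154 (3c) twin-width seat `ym-routeR-w1` (gen 6); row (R4′) (namer ★p1 g15 → ★★OWNER g28 interim word 2026-08-28 22:36Z «routeR-w1: assembly (α) GO»; standing PASS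
R4′).  THEOREMS ONLY (0 `def`, 0 `sorry`); `--supports stmt-QuantumFields-19200`, count-neutral.  YM₃ on T³ is a ladder rung (R3), not the Clay problem; nothing here claims a stub,
the crux, d = 4 or the mass gap.

WHAT (ns `…Theorems.Prop7CombLoopSquareCount`; `V : Site d → Fin d → 𝔸ˣ` bi-contractive, `m : 𝔸`, `(finRange d).reverse = s ++ μ :: t`, box `[−R,R]^d` inline).
* §1 `hol_base_prefix_nonneg` ∕ `hol_base_prefix_neg` (the rung transports of ✓ `comm_hol_contour27_le_of_nonneg∕_of_neg` are `V(Γ_(0,q_k))`, by ✓ `hol_append`, ✓ `seg_of_neg`,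
  ✓ `treeWord_disp_prefix`), ★★ `comm_loop_le_canonical_rungs` (both sign cases: `N_m(loop) ≤ Σ_(k<|B|) √f(q_k, b_k)`), ★★ `comm_loop_sq_le` (Cauchy–Schwarz: `≤ |B|·Σ_k f`).
* §2 ★★★ `sum_box_comm_loop_sq_le` — the title bound (px9's ✓ `sum_box_sum_combRungs_le` + ✓ `length_flatMap_seg_le`).
HONEST SCOPE.  ℤ^d bookkeeping; the T³ plug into ✓p671704 §3 (offset family ✓p671968, per offset `h` with `m := R(W(segment)⁻¹)φ₀(c_y)` and base `c_y + h·e_ι`) and the displayed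
averaged-path (Kg′) row are the next∕last file of (R4′)'s Dirichlet group; no booking here.

References: T. Bałaban, CMP 98 (1985) 17–51 [Balaban1985Averaging] ((9) pp.18–19, (19)–(20) p.21, p.24); CMP 102 (1985) 255–275 [Balaban1985UV3] ((27) p.263).
-/

set_option autoImplicit false

noncomputable section

open scoped BigOperators

namespace Summit.QuantumFields.YangMills.Theorems.Prop7CombLoopSquareCount

open Literature.MathematicalPhysics.QuantumFieldTheory.Balaban1983to89
open B7Prop1Explicit (Site Letter e disp revWord seg treeWord hol stepHol hol_append hol_cons hol_nil disp_append)
open B10Eq27AxialLog (contour27)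
open B9Eq39Adjoint (R)
open Summit.QuantumFields.YangMills.Theorems.Prop7CombLadder (seg_of_neg comm_hol_contour27_le_of_nonneg comm_hol_contour27_le_of_neg bicontr_hol)
open Summit.QuantumFields.YangMills.Theorems.Prop7CombLadderCount (sum_box_sum_combRungs_le length_flatMap_seg_le disp_base_neg disp_base_nonneg)
open Summit.QuantumFields.YangMills.Theorems.Prop7CombLadderCountOffset (treeWord_disp_prefix)

variable {d : ℕ} {𝔸 : Type*} [NormedRing 𝔸] [NormOneClass 𝔸] (V : Site d → Fin d → 𝔸ˣ)
  (hV : ∀ (x : Site d) (κ : Fin d), ‖(V x κ : 𝔸)‖ ≤ 1 ∧ ‖(((V x κ)⁻¹ : 𝔸ˣ) : 𝔸)‖ ≤ 1)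

/-! ## §1 The canonical rung transport and the loop bound in both sign cases -/

section Canonical

variable {G : Type*} [Group G] (W : Site d → Fin d → G)

/-- the rung transport of the `v μ ≥ 0` case is the comb to the rung position: `W(A ++ S)·W_(q)(B↾k) = W(Γ_(0,q_k))`. [cite: Balaban1985Averaging, (9) p.18, p.24] -/
theorem hol_base_prefix_nonneg (μ : Fin d) {s t : List (Fin d)} (h : (List.finRange d).reverse = s ++ μ :: t) (v : Site d) (k : ℕ)
    (hk : k ≤ (t.flatMap (fun κ => seg κ (v κ))).length) :
    hol W 0 (s.flatMap (fun κ => seg κ (v κ)) ++ seg μ (v μ)) * hol W (disp (s.flatMap (fun κ => seg κ (v κ)) ++ seg μ (v μ))) ((t.flatMap (fun κ => seg κ (v κ))).take k)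
      = hol W 0 (treeWord (disp (s.flatMap (fun κ => seg κ (v κ)) ++ seg μ (v μ)) + disp ((t.flatMap (fun κ => seg κ (v κ))).take k))) := by
  rw [treeWord_disp_prefix_eq W μ h v k hk,
    hol_append W 0 (s.flatMap (fun κ => seg κ (v κ)) ++ seg μ (v μ)) ((t.flatMap (fun κ => seg κ (v κ))).take k), zero_add]
where
  /-- helper: `Γ(disp(A ++ S) + disp(B↾k)) = A ++ S ++ B↾k` (✓ `treeWord_disp_prefix` with `disp_append`). -/
  treeWord_disp_prefix_eq (W : Site d → Fin d → G) (μ : Fin d) {s t : List (Fin d)} (h : (List.finRange d).reverse = s ++ μ :: t) (v : Site d) (k : ℕ)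
      (hk : k ≤ (t.flatMap (fun κ => seg κ (v κ))).length) :
      treeWord (disp (s.flatMap (fun κ => seg κ (v κ)) ++ seg μ (v μ)) + disp ((t.flatMap (fun κ => seg κ (v κ))).take k))
        = (s.flatMap (fun κ => seg κ (v κ)) ++ seg μ (v μ)) ++ (t.flatMap (fun κ => seg κ (v κ))).take k := by
    rw [← disp_append, treeWord_disp_prefix μ h v k hk]

/-- the rung transport of the `v μ < 0` case is the same comb: `W(A ++ S′)·W(μ̄ at its end)·W_(q−e_μ)(B↾k) = W(Γ_(0,q_k))`. [cite: Balaban1985Averaging, (9) p.18, p.24] -/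
theorem hol_base_prefix_neg (μ : Fin d) {s t : List (Fin d)} (h : (List.finRange d).reverse = s ++ μ :: t) (v : Site d) (hv : v μ < 0) (k : ℕ)
    (hk : k ≤ (t.flatMap (fun κ => seg κ (v κ))).length) :
    hol W 0 (s.flatMap (fun κ => seg κ (v κ)) ++ seg μ (v μ + 1)) * stepHol W (disp (s.flatMap (fun κ => seg κ (v κ)) ++ seg μ (v μ + 1))) (μ, false)
        * hol W (disp (s.flatMap (fun κ => seg κ (v κ)) ++ seg μ (v μ + 1)) - e μ) ((t.flatMap (fun κ => seg κ (v κ))).take k)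
      = hol W 0 (treeWord (disp (s.flatMap (fun κ => seg κ (v κ)) ++ seg μ (v μ)) + disp ((t.flatMap (fun κ => seg κ (v κ))).take k))) := by
  have hAS : s.flatMap (fun κ => seg κ (v κ)) ++ seg μ (v μ) = (s.flatMap (fun κ => seg κ (v κ)) ++ seg μ (v μ + 1)) ++ [(μ, false)] := by
    rw [seg_of_neg μ hv, List.append_assoc]
  have hbase : disp (s.flatMap (fun κ => seg κ (v κ)) ++ seg μ (v μ + 1)) - e μ = disp (s.flatMap (fun κ => seg κ (v κ)) ++ seg μ (v μ)) := by
    rw [disp_base_neg, disp_base_nonneg]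
  have h1 : hol W 0 (s.flatMap (fun κ => seg κ (v κ)) ++ seg μ (v μ + 1)) * stepHol W (disp (s.flatMap (fun κ => seg κ (v κ)) ++ seg μ (v μ + 1))) (μ, false)
      = hol W 0 (s.flatMap (fun κ => seg κ (v κ)) ++ seg μ (v μ)) := by
    rw [hAS, hol_append W 0 (s.flatMap (fun κ => seg κ (v κ)) ++ seg μ (v μ + 1)) [(μ, false)], zero_add, hol_cons, hol_nil, mul_one]
  rw [h1, hbase]
  exact hol_base_prefix_nonneg W μ h v k hk

end Canonical

include hV

/-- ★★ **THE LOOP COMMUTATOR AGAINST CANONICAL RUNGS** (both sign cases of the `μ`-run): `N_m(V(Γ_(0,v) ∪ μ ∪ −Γ_(0,v+e_μ))) ≤ Σ_(k<|B|) N_(R(V(Γ_(0,q_k))⁻¹)m)(V_(q_k)(b_k μ b̄_k μ̄))`,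
`q_k = disp(A ++ S) + disp(B↾k)`. [cite: Balaban1985UV3, (27) p.263; Balaban1985Averaging, (9) pp.18-19, (19)-(20) p.21] -/
theorem comm_loop_le_canonical_rungs (μ : Fin d) {s t : List (Fin d)} (h : (List.finRange d).reverse = s ++ μ :: t) (hs : μ ∉ s) (ht : μ ∉ t)
    (v : Site d) (m : 𝔸) :
    ‖((hol V 0 (contour27 0 v μ) : 𝔸ˣ) : 𝔸) * m - m * ((hol V 0 (contour27 0 v μ) : 𝔸ˣ) : 𝔸)‖
      ≤ ∑ k ∈ Finset.range (t.flatMap (fun κ => seg κ (v κ))).length,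
          ‖((hol V (disp (s.flatMap (fun κ => seg κ (v κ)) ++ seg μ (v μ)) + disp ((t.flatMap (fun κ => seg κ (v κ))).take k))
                [(t.flatMap (fun κ => seg κ (v κ))).getD k (μ, true), (μ, true), ((t.flatMap (fun κ => seg κ (v κ))).getD k (μ, true)).rev, (μ, false)] : 𝔸ˣ) : 𝔸)
              * R (hol V 0 (treeWord (disp (s.flatMap (fun κ => seg κ (v κ)) ++ seg μ (v μ)) + disp ((t.flatMap (fun κ => seg κ (v κ))).take k))))⁻¹ m
            - R (hol V 0 (treeWord (disp (s.flatMap (fun κ => seg κ (v κ)) ++ seg μ (v μ)) + disp ((t.flatMap (fun κ => seg κ (v κ))).take k))))⁻¹ m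
              * ((hol V (disp (s.flatMap (fun κ => seg κ (v κ)) ++ seg μ (v μ)) + disp ((t.flatMap (fun κ => seg κ (v κ))).take k))
                [(t.flatMap (fun κ => seg κ (v κ))).getD k (μ, true), (μ, true), ((t.flatMap (fun κ => seg κ (v κ))).getD k (μ, true)).rev, (μ, false)] : 𝔸ˣ) : 𝔸)‖ := by
  rcases le_or_gt 0 (v μ) with hv | hv
  · refine (comm_hol_contour27_le_of_nonneg V hV v μ h hs ht hv m).trans (Finset.sum_le_sum fun k hk => le_of_eq ?_)
    have hk' : k ≤ (t.flatMap (fun κ => seg κ (v κ))).length := (Finset.mem_range.mp hk).le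
    rw [← B9Eq39Adjoint.R_mul, ← mul_inv_rev, hol_base_prefix_nonneg V μ h v k hk']
  · refine (comm_hol_contour27_le_of_neg V hV v μ h hs ht hv m).trans (Finset.sum_le_sum fun k hk => le_of_eq ?_)
    have hk' : k ≤ (t.flatMap (fun κ => seg κ (v κ))).length := (Finset.mem_range.mp hk).le
    have hbase : disp (s.flatMap (fun κ => seg κ (v κ)) ++ seg μ (v μ + 1)) - e μ = disp (s.flatMap (fun κ => seg κ (v κ)) ++ seg μ (v μ)) := by
      rw [disp_base_neg, disp_base_nonneg]
    rw [← B9Eq39Adjoint.R_mul, ← mul_inv_rev, hol_base_prefix_neg V μ h v hv k hk', hbase]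


omit hV [NormOneClass 𝔸] in
/-- Cauchy–Schwarz in the form used below: `0 ≤ x ≤ Σ_(k∈s) g k ⇒ x² ≤ #s·Σ g²`. [folklore] -/
theorem sq_le_card_mul_sum_sq_of_le {x : ℝ} (s : Finset ℕ) (g : ℕ → ℝ) (hx : 0 ≤ x) (hle : x ≤ ∑ k ∈ s, g k) :
    x ^ 2 ≤ (s.card : ℝ) * ∑ k ∈ s, g k ^ 2 :=
  (pow_le_pow_left₀ hx hle 2).trans sq_sum_le_card_mul_sum_sq

/-- ★★ **CAUCHY–SCHWARZ**: `N_m(loop)² ≤ |B|·Σ_(k<|B|) f(q_k, b_k)`, `f(q,l) = N_(R(V(Γ_(0,q))⁻¹)m)(V_q(l μ l̄ μ̄))²`. [cite: Balaban1985Averaging, (19)-(20) p.21] -/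
theorem comm_loop_sq_le (μ : Fin d) {s t : List (Fin d)} (h : (List.finRange d).reverse = s ++ μ :: t) (hs : μ ∉ s) (ht : μ ∉ t)
    (v : Site d) (m : 𝔸) :
    ‖((hol V 0 (contour27 0 v μ) : 𝔸ˣ) : 𝔸) * m - m * ((hol V 0 (contour27 0 v μ) : 𝔸ˣ) : 𝔸)‖ ^ 2
      ≤ ((t.flatMap (fun κ => seg κ (v κ))).length : ℝ) * ∑ k ∈ Finset.range (t.flatMap (fun κ => seg κ (v κ))).length,
          ‖((hol V (disp (s.flatMap (fun κ => seg κ (v κ)) ++ seg μ (v μ)) + disp ((t.flatMap (fun κ => seg κ (v κ))).take k))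
                [(t.flatMap (fun κ => seg κ (v κ))).getD k (μ, true), (μ, true), ((t.flatMap (fun κ => seg κ (v κ))).getD k (μ, true)).rev, (μ, false)] : 𝔸ˣ) : 𝔸)
              * R (hol V 0 (treeWord (disp (s.flatMap (fun κ => seg κ (v κ)) ++ seg μ (v μ)) + disp ((t.flatMap (fun κ => seg κ (v κ))).take k))))⁻¹ m
            - R (hol V 0 (treeWord (disp (s.flatMap (fun κ => seg κ (v κ)) ++ seg μ (v μ)) + disp ((t.flatMap (fun κ => seg κ (v κ))).take k))))⁻¹ m
              * ((hol V (disp (s.flatMap (fun κ => seg κ (v κ)) ++ seg μ (v μ)) + disp ((t.flatMap (fun κ => seg κ (v κ))).take k))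
                [(t.flatMap (fun κ => seg κ (v κ))).getD k (μ, true), (μ, true), ((t.flatMap (fun κ => seg κ (v κ))).getD k (μ, true)).rev, (μ, false)] : 𝔸ˣ) : 𝔸)‖ ^ 2 := by
  have h := sq_le_card_mul_sum_sq_of_le _ _ (norm_nonneg _) (comm_loop_le_canonical_rungs V hV μ h hs ht v m)
  rwa [Finset.card_range] at h

/-! ## §2 Summed over the box: px9's count with the canonical letter -/

/-- ★★★ **THE COMB-LOOP COMMUTATOR SQUARED, SUMMED OVER THE BOX**: with `f(q,l) := N_(R(V(Γ_(0,q))⁻¹)m)(V_q(l μ l̄ μ̄))²`,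
`Σ_(v∈[−R,R]^d) N_m(V(Γ_(0,v) ∪ μ ∪ −Γ_(0,v+e_μ)))² ≤ (|t|·R)·Σ_(i<|t|) (2R+1)^(|t|−i)·Σ_(q∈[−R,R]^d) (f(q,(t_i,+)) + f(q,(t_i,−)))`.
[cite: Balaban1985UV3, (27) p.263; Balaban1985Averaging, (9) pp.18-19, (19)-(20) p.21, p.24] -/
theorem sum_box_comm_loop_sq_le (R₀ : ℕ) (μ : Fin d) {s t : List (Fin d)} (h : (List.finRange d).reverse = s ++ μ :: t) (hs : μ ∉ s) (ht : μ ∉ t) (m : 𝔸) :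
    ∑ v ∈ Fintype.piFinset (fun _ : Fin d => Finset.Icc (-(R₀ : ℤ)) (R₀ : ℤ)),
        ‖((hol V 0 (contour27 0 v μ) : 𝔸ˣ) : 𝔸) * m - m * ((hol V 0 (contour27 0 v μ) : 𝔸ˣ) : 𝔸)‖ ^ 2
      ≤ ((t.length * R₀ : ℕ) : ℝ) * ∑ i ∈ Finset.range t.length, (((2 * R₀ + 1) ^ (t.length - i) : ℕ) : ℝ)
          * ∑ q ∈ Fintype.piFinset (fun _ : Fin d => Finset.Icc (-(R₀ : ℤ)) (R₀ : ℤ)),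
              (‖((hol V q [(t.getD i μ, true), (μ, true), B7Prop1Explicit.Letter.rev (t.getD i μ, true), (μ, false)] : 𝔸ˣ) : 𝔸) * R (hol V 0 (treeWord q))⁻¹ m
                  - R (hol V 0 (treeWord q))⁻¹ m * ((hol V q [(t.getD i μ, true), (μ, true), B7Prop1Explicit.Letter.rev (t.getD i μ, true), (μ, false)] : 𝔸ˣ) : 𝔸)‖ ^ 2
              + ‖((hol V q [(t.getD i μ, false), (μ, true), B7Prop1Explicit.Letter.rev (t.getD i μ, false), (μ, false)] : 𝔸ˣ) : 𝔸) * R (hol V 0 (treeWord q))⁻¹ m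
                  - R (hol V 0 (treeWord q))⁻¹ m * ((hol V q [(t.getD i μ, false), (μ, true), B7Prop1Explicit.Letter.rev (t.getD i μ, false), (μ, false)] : 𝔸ˣ) : 𝔸)‖ ^ 2) := by
  -- per `v`: Cauchy–Schwarz with `|B| ≤ |t|·R₀`, then the count with the canonical letter
  have hper : ∀ v ∈ Fintype.piFinset (fun _ : Fin d => Finset.Icc (-(R₀ : ℤ)) (R₀ : ℤ)),
      ‖((hol V 0 (contour27 0 v μ) : 𝔸ˣ) : 𝔸) * m - m * ((hol V 0 (contour27 0 v μ) : 𝔸ˣ) : 𝔸)‖ ^ 2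
        ≤ ((t.length * R₀ : ℕ) : ℝ) * ∑ k ∈ Finset.range (t.flatMap (fun κ => seg κ (v κ))).length,
            (fun q l => ‖((hol V q [l, (μ, true), l.rev, (μ, false)] : 𝔸ˣ) : 𝔸) * R (hol V 0 (treeWord q))⁻¹ m
                - R (hol V 0 (treeWord q))⁻¹ m * ((hol V q [l, (μ, true), l.rev, (μ, false)] : 𝔸ˣ) : 𝔸)‖ ^ 2)
              (disp (s.flatMap (fun κ => seg κ (v κ)) ++ seg μ (v μ)) + disp ((t.flatMap (fun κ => seg κ (v κ))).take k))
              ((t.flatMap (fun κ => seg κ (v κ))).getD k (μ, true)) := by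
    intro v hv
    refine (comm_loop_sq_le V hV μ h hs ht v m).trans ?_
    refine mul_le_mul_of_nonneg_right ?_ (Finset.sum_nonneg fun k _ => sq_nonneg _)
    exact_mod_cast length_flatMap_seg_le t R₀ v hv
  have hcount := sum_box_sum_combRungs_le R₀ μ h
    (fun q l => ‖((hol V q [l, (μ, true), l.rev, (μ, false)] : 𝔸ˣ) : 𝔸) * R (hol V 0 (treeWord q))⁻¹ m
        - R (hol V 0 (treeWord q))⁻¹ m * ((hol V q [l, (μ, true), l.rev, (μ, false)] : 𝔸ˣ) : 𝔸)‖ ^ 2) (fun q b => sq_nonneg _)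
  refine (Finset.sum_le_sum hper).trans ?_
  rw [← Finset.mul_sum]
  exact mul_le_mul_of_nonneg_left hcount (by positivity)

end Summit.QuantumFields.YangMills.Theorems.Prop7CombLoopSquareCount

end
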